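import Literature.Analysis.FunctionSpaces.BesovCriticalRescaling
import Literature.Analysis.FunctionSpaces.BesovFatou
import Literature.Analysis.FunctionSpaces.BesovWeakStarCompactness
import HarnessLib

/-!
# Weak-* limits of bounded sequences of `Ḃ^s_{p,q}` determined by compactly supported tests

Analysis/FunctionSpaces proof file (theorems only: no definition, no named fact). The packaging of
the Fatou property of the homogeneous Besov spaces (Bahouri–Chemin–Danchin 2011, Thm. 2.25; the
tree's `BesovWeakStarCompactness.lean` (extraction) and `BesovFatou.lean` (the limit stays in the
space)) in the form in which blow-up arguments consume it: a bounded sequence of `Ḃ^s_{p,q}`,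
`-2 < s < 0`, whose pairings with every **compactly supported** test function converge — e.g.
because the underlying fields converge in `L¹_loc` — converges in `𝓢'` (the whole sequence, to one
limit), and the limit lies in `Ḃ^s_{p,q}` with the same bound:

* `TemperedDistribution.eq_of_forall_hasCompactSupport_apply_eq` — two tempered distributions
  which agree on compactly supported Schwartz functions are equal (compactly supported Schwartz
  functions are dense in `𝓢`, Hörmander I, Lemma 7.1.8; the tree's
  `exists_tsupport_subset_inter_closedBall_tendsto`);
* `exists_tendsto_of_forall_hasCompactSupport_tendsto` — **the packaging**: for `U n ∈ Ḃ^s_{p,q}`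
  with `‖U n‖_{Ḃ^s_{p,q}} ≤ M` and `⟨U n, θ⟩` convergent for every compactly supported `θ`, there is
  `W ∈ Ḃ^s_{p,q}`, `‖W‖_{Ḃ^s_{p,q}} ≤ M`, with `U n → W` in `𝓢'(E, F)` (every subsequence has a
  weak-* convergent sub-subsequence by `exists_strictMono_tendsto_of_memHomBesov`; all
  subsequential limits agree on compactly supported tests, hence coincide; the limit is in the
  space by `memHomBesov_of_tendsto`).

This is the step "(up to a subsequence) `u^k → v` … the lower semi-continuity of the norm gives
`‖v‖_{L^∞ Ḃ^{-1+3/p}_{p,q}} ≤ M`" of W. Wang, Z. Zhang, Sci. China Math. 60 (2017) =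
arXiv:1510.02589, §4 Step 1, and "`u_0^{(n)} ⇀ v₀` in `Ḃ^{s_p}_{p,p}`" of D. Albritton, Anal. PDE
11 (2018) = arXiv:1612.04439, §3 Step 1, for the slices of rescaled Navier–Stokes solutions.

## References

* H. Bahouri, J.-Y. Chemin, R. Danchin, *Fourier Analysis and Nonlinear PDE* (2011), Thm. 2.25.
  [BahouriCheminDanchin2011]
* W. Wang, Z. Zhang, Sci. China Math. 60 (2017) 637–650 = arXiv:1510.02589, §4 Step 1.
  [WangZhang2016]
* D. Albritton, Anal. PDE 11 (2018) 1415–1456 = arXiv:1612.04439, §3 Step 1. [Albritton2018]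
-/

noncomputable section

open MeasureTheory TemperedDistribution Filter Set Function
open _root_.Topology
open scoped SchwartzMap ENNReal NNReal

namespace Literature.Analysis.FunctionSpaces

/-! ## Tempered distributions are determined by compactly supported tests -/

section Density

variable {E : Type*} [NormedAddCommGroup E] [NormedSpace ℝ E] [FiniteDimensional ℝ E]
  {F : Type*} [NormedAddCommGroup F] [NormedSpace ℂ F]

/-- **Two tempered distributions which agree on all compactly supported Schwartz functions are
equal** (compactly supported Schwartz functions are dense in `𝓢(E, ℂ)`: the bump cut-offs
`χ(·/m) θ → θ`, Hörmander I, Lemma 7.1.8, in the tree as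
`exists_tsupport_subset_inter_closedBall_tendsto`; and distributions are continuous). [folklore] -/
theorem _root_.Literature.Analysis.FunctionSpaces.TemperedDistribution.eq_of_forall_hasCompactSupport_apply_eq
    {W₁ W₂ : 𝓢'(E, F)}
    (h : ∀ θ : 𝓢(E, ℂ), HasCompactSupport (θ : E → ℂ) → W₁ θ = W₂ θ) : W₁ = W₂ := by
  ext θ
  obtain ⟨u, hu, hlim⟩ :=
    Literature.MathematicalPhysics.QuantumLattice.exists_tsupport_subset_inter_closedBall_tendsto θ
  have hcs : ∀ m, HasCompactSupport ((u m : 𝓢(E, ℂ)) : E → ℂ) := fun m =>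
    IsCompact.of_isClosed_subset (isCompact_closedBall (0 : E) _) (isClosed_tsupport _)
      ((hu m).trans inter_subset_right)
  have h1 : Tendsto (fun m => W₁ (u m)) atTop (𝓝 (W₁ θ)) := (W₁.continuous.tendsto θ).comp hlim
  have h2 : Tendsto (fun m => W₂ (u m)) atTop (𝓝 (W₂ θ)) := (W₂.continuous.tendsto θ).comp hlim
  have he : (fun m => W₁ (u m)) = fun m => W₂ (u m) := funext fun m => h (u m) (hcs m)
  rw [he] at h1
  exact tendsto_nhds_unique h1 h2

omit [FiniteDimensional ℝ E] in
/-- A weak-* convergent sequence whose pairings with compactly supported tests have prescribed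
limits: the limit distribution has those pairings. [folklore] -/
theorem _root_.Literature.Analysis.FunctionSpaces.TemperedDistribution.apply_eq_of_tendsto_of_tendsto_apply
    {U : ℕ → 𝓢'(E, F)} {W : 𝓢'(E, F)} {φ : ℕ → ℕ} (hφ : StrictMono φ)
    (hW : Tendsto (fun n => U (φ n)) atTop (𝓝 W)) {θ : 𝓢(E, ℂ)} {c : F}
    (hc : Tendsto (fun n => U n θ) atTop (𝓝 c)) : W θ = c :=
  tendsto_nhds_unique ((PointwiseConvergenceCLM.tendsto_iff_forall_tendsto.1 hW) θ)
    (hc.comp hφ.tendsto_atTop)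

end Density

/-! ## Bounded sequences of `Ḃ^s_{p,q}` convergent on compactly supported tests -/

section Packaging

variable {E : Type*} [NormedAddCommGroup E] [InnerProductSpace ℝ E] [FiniteDimensional ℝ E]
  [MeasurableSpace E] [BorelSpace E] {F : Type*} [NormedAddCommGroup F] [NormedSpace ℂ F]
  [CompleteSpace F] [ProperSpace F]

/-- **Bounded sequences of `Ḃ^s_{p,q}` whose compactly supported pairings converge, converge in
`𝓢'` to an element of `Ḃ^s_{p,q}` with the same bound** (`-2 < s < 0`, `1 ≤ p ≤ ∞`, `q ≠ 0`,
values in a finite-dimensional `F`; Bahouri–Chemin–Danchin 2011, Thm. 2.25 packaged for blow-up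
arguments — Wang–Zhang 2017, §4 Step 1; Albritton 2018, §3 Step 1). If `U n ∈ Ḃ^s_{p,q}`,
`‖U n‖_{Ḃ^s_{p,q}} ≤ M`, and for every compactly supported Schwartz `θ` the sequence `⟨U n, θ⟩`
converges, then there is `W ∈ Ḃ^s_{p,q}` with `‖W‖_{Ḃ^s_{p,q}} ≤ M` and `U n → W` in `𝓢'(E, F)`
(the whole sequence). Proof: every subsequence has a weak-* convergent sub-subsequence
(`exists_strictMono_tendsto_of_memHomBesov`, through `Ḃ^s_{p,q} ⊂ Ḃ^s_{p,∞}`); two subsequential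
limits agree on compactly supported tests, hence are equal
(`TemperedDistribution.eq_of_forall_hasCompactSupport_apply_eq`); so the sequence converges
(`tendsto_of_subseq_tendsto`), and the limit is in the space with the Fatou bound
(`memHomBesov_of_tendsto`). [cite: BahouriCheminDanchin2011, Thm. 2.25] -/
theorem exists_tendsto_of_forall_hasCompactSupport_tendsto {s : ℝ} (hs : -2 < s) (hs0 : s < 0)
    (p : ℝ≥0∞) [Fact (1 ≤ p)] {q : ℝ≥0∞} (hq : q ≠ 0) {M : ℝ≥0} {U : ℕ → 𝓢'(E, F)}
    (hmem : ∀ n, MemHomBesov s p q (U n)) (hM : ∀ n, eHomBesovNorm s p q (U n) ≤ M)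
    (hconv : ∀ θ : 𝓢(E, ℂ), HasCompactSupport (θ : E → ℂ) →
      ∃ c : F, Tendsto (fun n => U n θ) atTop (𝓝 c)) :
    ∃ W : 𝓢'(E, F), Tendsto U atTop (𝓝 W) ∧ MemHomBesov s p q W ∧
      eHomBesovNorm s p q W ≤ M := by
  -- the data in `Ḃ^{-σ}_{p,∞}`, `σ = -s ∈ (0, 2)`
  set σ : ℝ := -s with hσdef
  have hσ : 0 < σ := by rw [hσdef]; linarith
  have hσ2 : σ < 2 := by rw [hσdef]; linarith
  have hsσ : s = -σ := by rw [hσdef, neg_neg]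
  have hmem' : ∀ n, MemHomBesov (-σ) p ∞ (U n) := fun n => by
    rw [← hsσ]
    exact ⟨(eHomBesovNorm_top_le_eHomBesovNorm s p hq (U n)).trans_lt (hmem n).1, (hmem n).2⟩
  have hM' : ∀ n, eHomBesovNorm (-σ) p ∞ (U n) ≤ M := fun n => by
    rw [← hsσ]
    exact (eHomBesovNorm_top_le_eHomBesovNorm s p hq (U n)).trans (hM n)
  -- every subsequence has a weak-* convergent sub-subsequence
  have hsub : ∀ ns : ℕ → ℕ, StrictMono ns → ∃ (V : 𝓢'(E, F)) (ms : ℕ → ℕ), StrictMono ms ∧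
      Tendsto (fun n => U (ns (ms n))) atTop (𝓝 V) := fun ns hns =>
    exists_strictMono_tendsto_of_memHomBesov p hσ hσ2 (fun n => hmem' (ns n)) fun n => hM' (ns n)
  -- one subsequential limit `W`
  obtain ⟨W, φ₀, hφ₀, hW⟩ := hsub id strictMono_id
  -- pairings of `W` with compactly supported tests are the limits of `⟨U n, θ⟩`
  choose c hc using hconv
  have hWc : ∀ (θ : 𝓢(E, ℂ)) (hθ : HasCompactSupport (θ : E → ℂ)), W θ = c θ hθ :=
    fun θ hθ => TemperedDistribution.apply_eq_of_tendsto_of_tendsto_apply hφ₀ hW (hc θ hθ)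
  -- the whole sequence converges to `W`
  have hconvW : Tendsto U atTop (𝓝 W) := by
    refine tendsto_of_subseq_tendsto fun ns hns => ?_
    -- extract a strictly increasing sub-subsequence first, then a convergent one
    obtain ⟨ψ, hψ, hψ'⟩ := strictMono_subseq_of_tendsto_atTop hns
    obtain ⟨V, ms, hms, hV⟩ := hsub (ns ∘ ψ) hψ'
    have hVW : V = W := by
      refine TemperedDistribution.eq_of_forall_hasCompactSupport_apply_eq fun θ hθ => ?_
      rw [hWc θ hθ]
      -- `⟨U (ns (ψ (ms n))), θ⟩ → V θ` and `→ c θ`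
      have h1 : Tendsto (fun n => U ((ns ∘ ψ) (ms n)) θ) atTop (𝓝 (V θ)) :=
        (PointwiseConvergenceCLM.tendsto_iff_forall_tendsto.1 hV) θ
      have h2 : Tendsto (fun n => U ((ns ∘ ψ) (ms n)) θ) atTop (𝓝 (c θ hθ)) :=
        (hc θ hθ).comp ((hns.comp hψ.tendsto_atTop).comp hms.tendsto_atTop)
      exact tendsto_nhds_unique h1 h2
    exact ⟨ψ ∘ ms, by rw [← hVW]; exact hV⟩
  -- the limit lies in `Ḃ^s_{p,q}` with the Fatou bound
  obtain ⟨hWmem, hWM⟩ := memHomBesov_of_tendsto hconvW hs hs0 p hq ENNReal.coe_ne_top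
    (Eventually.of_forall hmem) (Eventually.of_forall hM)
  exact ⟨W, hconvW, hWmem, hWM⟩

/-- **The same with prescribed limits**: if `⟨U n, θ⟩ → L θ` for every compactly supported `θ`, the
limit `W` satisfies `⟨W, θ⟩ = L θ` for all such `θ` (so `W` is *the* distribution extending the
local limit). [cite: BahouriCheminDanchin2011, Thm. 2.25] -/
theorem exists_tendsto_of_forall_hasCompactSupport_tendsto' {s : ℝ} (hs : -2 < s) (hs0 : s < 0)
    (p : ℝ≥0∞) [Fact (1 ≤ p)] {q : ℝ≥0∞} (hq : q ≠ 0) {M : ℝ≥0} {U : ℕ → 𝓢'(E, F)}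
    (hmem : ∀ n, MemHomBesov s p q (U n)) (hM : ∀ n, eHomBesovNorm s p q (U n) ≤ M)
    {L : 𝓢(E, ℂ) → F}
    (hconv : ∀ θ : 𝓢(E, ℂ), HasCompactSupport (θ : E → ℂ) →
      Tendsto (fun n => U n θ) atTop (𝓝 (L θ))) :
    ∃ W : 𝓢'(E, F), Tendsto U atTop (𝓝 W) ∧ MemHomBesov s p q W ∧
      eHomBesovNorm s p q W ≤ M ∧
      ∀ θ : 𝓢(E, ℂ), HasCompactSupport (θ : E → ℂ) → W θ = L θ := by
  obtain ⟨W, hW, hmemW, hWM⟩ := exists_tendsto_of_forall_hasCompactSupport_tendsto hs hs0 p hq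
    hmem hM fun θ hθ => ⟨L θ, hconv θ hθ⟩
  refine ⟨W, hW, hmemW, hWM, fun θ hθ => ?_⟩
  exact tendsto_nhds_unique ((PointwiseConvergenceCLM.tendsto_iff_forall_tendsto.1 hW) θ)
    (hconv θ hθ)

end Packaging

end Literature.Analysis.FunctionSpaces

end
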